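import Literature.AnabelianGeometry.AbsoluteAnabelian.AbsTopIProp23iiAlmostProSigmaModel
import Literature.AnabelianGeometry.AbsoluteAnabelian.ProfiniteFiniteNormalTorsionFree
import HarnessLib

/-!
# [AbsTopI] Prop 2.2 / 2.3 at the ALMOST pro-`Σ` model: (FN) replaced by «torsion-free ∧ outer-faithful»

S. Mochizuki, *Topics in Absolute Anabelian Geometry I: Generalities* (2012) [AbsTopI], Def 2.1 (i) p. 18
(GFG-type: `Δ` is the maximal ALMOST pro-`Σ` quotient of `Δ_X` attached to a finite étale Galois covering
`Y → X` of a hyperbolic orbicurve, so that `Δ` contains the OPEN NORMAL subgroup `U := Δ_Y^Σ`, a pro-`Σ`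
surface group, with `Δ / U = Gal(Y/X)`), Prop 2.2 p. 18, Prop 2.3 (i)(ii) p. 19.

The cell's almost pro-`Σ` model theorems (`AbsTopIProp23iAlmostProSigmaHyperbolic`,
`AbsTopIProp23iiAlmostProSigmaModel`) prove Prop 2.2 / 2.3 for a profinite `Δ` with an open subgroup `U`
presented as a pro-`Σ` completion of a hyperbolic surface group `Γ_{g,r}`, MODULO the input
(FN) «`Δ` has no nontrivial finite normal subgroup» — an input shown NECESSARY at that level of abstraction
(`ProfiniteSlimAscentSharp`: `Δ' × F`).  abc-iut-w6-d030's `ProfiniteFiniteNormalTorsionFree` derives (FN), for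
ANY group, from an open normal `U` that is TORSION-FREE with TRIVIAL CENTRALISER — equivalently (for centre-free
`U`) on which `Δ` acts OUTER-FAITHFULLY (`Δ / U ↪ Out U`).  THIS PROOF-ONLY FILE composes the two BY NAME:

* `slim_and_elastic_of_isProSigmaCompletion_hyperbolic` — every pro-`Σ` completion of a hyperbolic `Γ_{g,r}`
  (closed or punctured) is slim and elastic (the two model files of record, unified over `(g, r)`);
* `slim_and_elastic_of_isOpen_proSigma_hyperbolic_of_torsionFree` /
  `…_of_outerFaithful` — Prop 2.3 (i) for the almost pro-`Σ` `Δ` with (FN) replaced by «some normal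
  torsion-free `V` with `Z_Δ(V) = 1`» / by «`U` normal, torsion-free, and `Δ → Out U` injective»;
* `FundamentalExtension.geomSlimElastic_of_isOpen_proSigma_hyperbolic_of_torsionFree` / `…_of_outerFaithful` —
  the typed node predicate `E.GeomSlimElastic` (F-0239) under the same inputs;
* `FundamentalExtension.prop22_prop23_of_isOpen_proSigma_hyperbolic_mlf_of_outerFaithful` / `_nf_…` —
  **`E.GeomTFG ∧ E.GeomSlimElastic ∧ E.ArithSlimNotElastic`** (Prop 2.2 + 2.3 (i) + 2.3 (ii)) for MLF / NF base data.

HONEST SCOPE: the residual inputs «`U = Δ_Y^Σ` is torsion-free» and «`Gal(Y/X)` acts outer-faithfully on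
`Δ_Y^Σ`» are genuinely GEOMETRIC (true for hyperbolic orbicurves: pro-`Σ` surface groups are torsion-free, and a
nontrivial automorphism of `Y` acts nontrivially on `Δ_Y^Σ` up to inner automorphism); they are NOT typed as
facts here and NOT discharged — this file reduces print's almost pro-`Σ` case of Prop 2.3 (i) to exactly them.
«Torsion-free» is print's sense (no nontrivial element of finite order), as in `ProfiniteFiniteNormalTorsionFree`.
Classical; OUR kernel check; nothing here bears on [IUTchIII] Cor. 3.12; no side is taken.
-/

noncomputable section

open Topology

universe u

namespace Literature.AnabelianGeometry.AbsoluteAnabelian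

open Literature.AlgebraicGeometry.Frobenioids (IsSlimGroup)
open Literature.AnabelianGeometry.SemiGraphs.SemiGraphOfAnabelioids
open Literature.GroupTheory.CombinatorialGroupTheory

/-! ### The pro-`Σ` surface group itself: slim and elastic for every hyperbolic `(g, r)` -/

/-- **Pro-`Σ` completions of hyperbolic surface groups are slim and elastic** (`2g − 2 + r > 0`, `Σ` a nonempty
set of primes): the closed case `r = 0`, `g ≥ 2` is `slim_and_elastic_of_isProSigmaCompletion_closedSurfaceGroup`,
the punctured case `r ≥ 1` is `slim_and_elastic_of_isProSigmaCompletion_puncturedSurfaceGroup`.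
[cite: MochizukiAbsTopI2012, Prop 2.3 (i) p.19] -/
theorem slim_and_elastic_of_isProSigmaCompletion_hyperbolic {P : Type u} [Group P] [TopologicalSpace P]
    [IsTopologicalGroup P] [CompactSpace P] [T2Space P] [TotallyDisconnectedSpace P] {Sigma : Set ℕ}
    (hS : Sigma.Nonempty) (hSp : ∀ p ∈ Sigma, p.Prime) {g r : ℕ} (hgr : PuncturedSurfaceGroup.IsHyperbolicType g r)
    (ι : PuncturedSurfaceGroup g r →* P) (hι : IsProSigmaCompletion Sigma ι) : IsSlimGroup P ∧ IsElastic P := by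
  rcases Nat.eq_zero_or_pos r with hr | hr
  · subst hr
    have hg : 2 ≤ g := by
      unfold PuncturedSurfaceGroup.IsHyperbolicType at hgr
      omega
    exact IsProSigmaCompletion.slim_and_elastic_of_isProSigmaCompletion_closedSurfaceGroup Sigma hS hSp g hg P ι hι
  · obtain ⟨ℓ, hℓ⟩ := hS
    exact slim_and_elastic_of_isProSigmaCompletion_puncturedSurfaceGroup hr hgr hι ⟨ℓ, hℓ, hSp ℓ hℓ⟩

variable {G : Type u} [Group G] [TopologicalSpace G] [IsTopologicalGroup G] [CompactSpace G] [T2Space G]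
  [TotallyDisconnectedSpace G]

/-- An open subgroup `U` of a profinite `G` presented as a pro-`Σ` completion of a hyperbolic `Γ_{g,r}` is
centre-free: `Z(U) = 1` (slim groups have trivial centralisers of open subgroups; take the open subgroup `U ≤ U`).
[cite: MochizukiAbsTopI2012, Prop 2.3 (i) p.19] -/
theorem centralizer_top_eq_bot_of_isOpen_proSigma_hyperbolic {Sigma : Set ℕ} (hS : Sigma.Nonempty)
    (hSp : ∀ p ∈ Sigma, p.Prime) {g r : ℕ} (hgr : PuncturedSurfaceGroup.IsHyperbolicType g r)
    (U : Subgroup G) (hUo : IsOpen (U : Set G)) (ι : PuncturedSurfaceGroup g r →* U)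
    (hι : IsProSigmaCompletion Sigma ι) : Subgroup.centralizer ((⊤ : Subgroup U) : Set U) = ⊥ := by
  haveI : CompactSpace U := isCompact_iff_compactSpace.mp (Subgroup.isClosed_of_isOpen U hUo).isCompact
  exact centralizer_top_eq_bot_of_isSlimGroup (slim_and_elastic_of_isProSigmaCompletion_hyperbolic hS hSp hgr ι hι).1

/-! ### Prop 2.3 (i) for the almost pro-`Σ` group: (FN) from torsion-freeness + trivial centraliser -/

/-- **Prop 2.3 (i), almost pro-`Σ` model, (FN) discharged by a torsion-free normal subgroup with trivial
centraliser**: a profinite `G` containing an OPEN subgroup `U` that is a pro-`Σ` completion of a hyperbolic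
`Γ_{g,r}` (`Σ` a nonempty set of primes) and a NORMAL subgroup `V` that is torsion-free with `Z_G(V) = 1` is slim
and elastic (`finite_normal_eq_bot_of_torsionFree_of_centralizer_eq_bot` supplies (FN);
`slim_and_elastic_of_isOpen_proSigma_hyperbolic` does the rest). [cite: MochizukiAbsTopI2012, Prop 2.3 (i) p.19] -/
theorem slim_and_elastic_of_isOpen_proSigma_hyperbolic_of_torsionFree {Sigma : Set ℕ} (hS : Sigma.Nonempty)
    (hSp : ∀ p ∈ Sigma, p.Prime) {g r : ℕ} (hgr : PuncturedSurfaceGroup.IsHyperbolicType g r)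
    (U : Subgroup G) (hUo : IsOpen (U : Set G)) (ι : PuncturedSurfaceGroup g r →* U)
    (hι : IsProSigmaCompletion Sigma ι) (V : Subgroup G) [V.Normal] (hV : ∀ v ∈ V, IsOfFinOrder v → v = 1)
    (hVc : Subgroup.centralizer (V : Set G) = ⊥) : IsSlimGroup G ∧ IsElastic G :=
  slim_and_elastic_of_isOpen_proSigma_hyperbolic hS hSp hgr U hUo ι hι
    (finite_normal_eq_bot_of_torsionFree_of_centralizer_eq_bot V hV hVc)

/-- **Prop 2.3 (i), almost pro-`Σ` model, OUTER-FAITHFUL form** — the shape of Def 2.1 (i): `G ⊇ U = Δ_Y^Σ` open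
NORMAL, a pro-`Σ` completion of a hyperbolic `Γ_{g,r}`, TORSION-FREE, and `G / U = Gal(Y/X)` acting outer-faithfully
on `U` (every `x ∈ G` acting on `U` as an inner automorphism of `U` lies in `U`).  Then `G` is slim and elastic
(`Z(U) = 1` by slimness of the model, so outer-faithfulness is `Z_G(U) = 1` by
`centralizer_eq_bot_iff_mem_of_conj_eq_conj`). [cite: MochizukiAbsTopI2012, Prop 2.3 (i) p.19] -/
theorem slim_and_elastic_of_isOpen_proSigma_hyperbolic_of_outerFaithful {Sigma : Set ℕ} (hS : Sigma.Nonempty)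
    (hSp : ∀ p ∈ Sigma, p.Prime) {g r : ℕ} (hgr : PuncturedSurfaceGroup.IsHyperbolicType g r)
    (U : Subgroup G) [U.Normal] (hUo : IsOpen (U : Set G)) (ι : PuncturedSurfaceGroup g r →* U)
    (hι : IsProSigmaCompletion Sigma ι) (hUt : ∀ u ∈ U, IsOfFinOrder u → u = 1)
    (hOut : ∀ x : G, (∃ u ∈ U, ∀ y ∈ U, x * y * x⁻¹ = u * y * u⁻¹) → x ∈ U) : IsSlimGroup G ∧ IsElastic G :=
  slim_and_elastic_of_isOpen_proSigma_hyperbolic_of_torsionFree hS hSp hgr U hUo ι hι U hUt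
    ((centralizer_eq_bot_iff_mem_of_conj_eq_conj U
      (centralizer_top_eq_bot_of_isOpen_proSigma_hyperbolic hS hSp hgr U hUo ι hι)).mpr hOut)

namespace FundamentalExtension

/-! ### The typed node predicates for extensions `1 → Δ → Π → G → 1` -/

/-- **F-0239 `GeomSlimElastic` at the almost pro-`Σ` model, (FN) from a torsion-free normal `V ≤ Δ` with
`Z_Δ(V) = 1`** (any universe, any hyperbolic `(g, r)`, `Σ` a nonempty set of primes).
[cite: MochizukiAbsTopI2012, Prop 2.3 (i) p.19] -/
theorem geomSlimElastic_of_isOpen_proSigma_hyperbolic_of_torsionFree (E : FundamentalExtension.{u}) {Sigma : Set ℕ}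
    (hS : Sigma.Nonempty) (hSp : ∀ p ∈ Sigma, p.Prime) {g r : ℕ} (hgr : PuncturedSurfaceGroup.IsHyperbolicType g r)
    (U : Subgroup E.geom) (hUo : IsOpen (U : Set E.geom)) (ι : PuncturedSurfaceGroup g r →* U)
    (hι : IsProSigmaCompletion Sigma ι) (V : Subgroup E.geom) [V.Normal]
    (hV : ∀ v ∈ V, IsOfFinOrder v → v = 1) (hVc : Subgroup.centralizer (V : Set E.geom) = ⊥) :
    E.GeomSlimElastic :=
  E.geomSlimElastic_of_isOpen_proSigma_hyperbolic hS hSp hgr U hUo ι hι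
    (finite_normal_eq_bot_of_torsionFree_of_centralizer_eq_bot V hV hVc)

/-- **F-0239 `GeomSlimElastic` at the almost pro-`Σ` model, OUTER-FAITHFUL form** (Def 2.1 (i) shape: `U = Δ_Y^Σ`
open normal in `Δ`, a torsion-free pro-`Σ` hyperbolic surface group on which `Δ / U = Gal(Y/X)` acts
outer-faithfully). [cite: MochizukiAbsTopI2012, Prop 2.3 (i) p.19] -/
theorem geomSlimElastic_of_isOpen_proSigma_hyperbolic_of_outerFaithful (E : FundamentalExtension.{u})
    {Sigma : Set ℕ} (hS : Sigma.Nonempty) (hSp : ∀ p ∈ Sigma, p.Prime) {g r : ℕ}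
    (hgr : PuncturedSurfaceGroup.IsHyperbolicType g r) (U : Subgroup E.geom) [U.Normal]
    (hUo : IsOpen (U : Set E.geom)) (ι : PuncturedSurfaceGroup g r →* U) (hι : IsProSigmaCompletion Sigma ι)
    (hUt : ∀ u ∈ U, IsOfFinOrder u → u = 1)
    (hOut : ∀ x : E.geom, (∃ u ∈ U, ∀ y ∈ U, x * y * x⁻¹ = u * y * u⁻¹) → x ∈ U) : E.GeomSlimElastic := by
  haveI : CompactSpace E.geom := isCompact_iff_compactSpace.mp E.isClosed_geom.isCompact
  exact slim_and_elastic_of_isOpen_proSigma_hyperbolic_of_outerFaithful hS hSp hgr U hUo ι hι hUt hOut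

variable {E : FundamentalExtension.{0}} {Sigma : Set ℕ} {g r : ℕ}

/-- **[AbsTopI] Prop 2.2 + 2.3 (i) + 2.3 (ii) at the almost pro-`Σ` model, MLF base, OUTER-FAITHFUL form**: for
`1 → Δ → Π → G → 1` with `G ≅ G_k` (`k` an MLF) whose `Δ` contains an open normal torsion-free `U`, a pro-`Σ`
completion of a hyperbolic `Γ_{g,r}`, with `Δ / U ↪ Out U`: `Δ` is topologically finitely generated, slim and
elastic, and `Π` is slim but not elastic. [cite: MochizukiAbsTopI2012, Prop 2.3 p.19] -/
theorem prop22_prop23_of_isOpen_proSigma_hyperbolic_mlf_of_outerFaithful (B : E.MLFBase) (hS : Sigma.Nonempty)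
    (hSp : ∀ p ∈ Sigma, p.Prime) (hgr : PuncturedSurfaceGroup.IsHyperbolicType g r) (U : Subgroup E.geom)
    [U.Normal] (hUo : IsOpen (U : Set E.geom)) (ι : PuncturedSurfaceGroup g r →* U)
    (hι : IsProSigmaCompletion Sigma ι) (hUt : ∀ u ∈ U, IsOfFinOrder u → u = 1)
    (hOut : ∀ x : E.geom, (∃ u ∈ U, ∀ y ∈ U, x * y * x⁻¹ = u * y * u⁻¹) → x ∈ U) :
    E.GeomTFG ∧ E.GeomSlimElastic ∧ E.ArithSlimNotElastic := by
  haveI : CompactSpace E.geom := isCompact_iff_compactSpace.mp E.isClosed_geom.isCompact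
  exact prop22_prop23_of_isOpen_proSigma_hyperbolic_mlf B hS hSp hgr U hUo ι hι
    (finite_normal_eq_bot_of_torsionFree_of_centralizer_eq_bot U hUt
      ((centralizer_eq_bot_iff_mem_of_conj_eq_conj U
        (centralizer_top_eq_bot_of_isOpen_proSigma_hyperbolic hS hSp hgr U hUo ι hι)).mpr hOut))

/-- **[AbsTopI] Prop 2.2 + 2.3 (i) + 2.3 (ii) at the almost pro-`Σ` model, NF base, OUTER-FAITHFUL form** (same
statement for number-field base data `G ≅ G_F`). [cite: MochizukiAbsTopI2012, Prop 2.3 p.19] -/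
theorem prop22_prop23_of_isOpen_proSigma_hyperbolic_nf_of_outerFaithful (B : E.NFBase) (hS : Sigma.Nonempty)
    (hSp : ∀ p ∈ Sigma, p.Prime) (hgr : PuncturedSurfaceGroup.IsHyperbolicType g r) (U : Subgroup E.geom)
    [U.Normal] (hUo : IsOpen (U : Set E.geom)) (ι : PuncturedSurfaceGroup g r →* U)
    (hι : IsProSigmaCompletion Sigma ι) (hUt : ∀ u ∈ U, IsOfFinOrder u → u = 1)
    (hOut : ∀ x : E.geom, (∃ u ∈ U, ∀ y ∈ U, x * y * x⁻¹ = u * y * u⁻¹) → x ∈ U) :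
    E.GeomTFG ∧ E.GeomSlimElastic ∧ E.ArithSlimNotElastic := by
  haveI : CompactSpace E.geom := isCompact_iff_compactSpace.mp E.isClosed_geom.isCompact
  exact prop22_prop23_of_isOpen_proSigma_hyperbolic_nf B hS hSp hgr U hUo ι hι
    (finite_normal_eq_bot_of_torsionFree_of_centralizer_eq_bot U hUt
      ((centralizer_eq_bot_iff_mem_of_conj_eq_conj U
        (centralizer_top_eq_bot_of_isOpen_proSigma_hyperbolic hS hSp hgr U hUo ι hι)).mpr hOut))

/-- **The torsion-free / trivial-centraliser form of the same conjunction** (MLF base; `V ⊴ Δ` torsion-free with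
`Z_Δ(V) = 1`, not necessarily equal to `U`). [cite: MochizukiAbsTopI2012, Prop 2.3 p.19] -/
theorem prop22_prop23_of_isOpen_proSigma_hyperbolic_mlf_of_torsionFree (B : E.MLFBase) (hS : Sigma.Nonempty)
    (hSp : ∀ p ∈ Sigma, p.Prime) (hgr : PuncturedSurfaceGroup.IsHyperbolicType g r) (U : Subgroup E.geom)
    (hUo : IsOpen (U : Set E.geom)) (ι : PuncturedSurfaceGroup g r →* U) (hι : IsProSigmaCompletion Sigma ι)
    (V : Subgroup E.geom) [V.Normal] (hV : ∀ v ∈ V, IsOfFinOrder v → v = 1)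
    (hVc : Subgroup.centralizer (V : Set E.geom) = ⊥) :
    E.GeomTFG ∧ E.GeomSlimElastic ∧ E.ArithSlimNotElastic :=
  prop22_prop23_of_isOpen_proSigma_hyperbolic_mlf B hS hSp hgr U hUo ι hι
    (finite_normal_eq_bot_of_torsionFree_of_centralizer_eq_bot V hV hVc)

/-- **The torsion-free / trivial-centraliser form of the same conjunction** (NF base).
[cite: MochizukiAbsTopI2012, Prop 2.3 p.19] -/
theorem prop22_prop23_of_isOpen_proSigma_hyperbolic_nf_of_torsionFree (B : E.NFBase) (hS : Sigma.Nonempty)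
    (hSp : ∀ p ∈ Sigma, p.Prime) (hgr : PuncturedSurfaceGroup.IsHyperbolicType g r) (U : Subgroup E.geom)
    (hUo : IsOpen (U : Set E.geom)) (ι : PuncturedSurfaceGroup g r →* U) (hι : IsProSigmaCompletion Sigma ι)
    (V : Subgroup E.geom) [V.Normal] (hV : ∀ v ∈ V, IsOfFinOrder v → v = 1)
    (hVc : Subgroup.centralizer (V : Set E.geom) = ⊥) :
    E.GeomTFG ∧ E.GeomSlimElastic ∧ E.ArithSlimNotElastic :=
  prop22_prop23_of_isOpen_proSigma_hyperbolic_nf B hS hSp hgr U hUo ι hι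
    (finite_normal_eq_bot_of_torsionFree_of_centralizer_eq_bot V hV hVc)

end FundamentalExtension

end Literature.AnabelianGeometry.AbsoluteAnabelian

end
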